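import Mathlib
import Literature.NumberTheory.LFunctions.Zhang2022.Section2FunctionalEquation
import Literature.NumberTheory.LFunctions.Zhang2022.Section2AnalyticRootY
import Literature.NumberTheory.LFunctions.SelbergClassDirichletProofs
import HarnessLib

/-!
# Zhang (2022), §2 (2.11)–(2.12): `M(½+it,ψ) = Y(½+it,ψ)L(½+it,ψ)` is real, and so is
# `iM′(½+it,ψ)`, kernel-checked

Topic `Literature/NumberTheory/LFunctions/Zhang2022` (Landau–Siegel autopsy tree; verdict-neutral).
Y. Zhang, *Discrete mean estimates and the Landau–Siegel zero*, arXiv:2211.02515v1 (2022) — **an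
unrefereed manuscript, a claimed result under adjudication** (cell pub-zhang: audit + repair census
of arXiv:2211.02515; no claim about Landau–Siegel) — §2, p. 5:

> Let `M(s,ψ) = Y(s,ψ)L(s,ψ)`. […] The functional equation (2.2) gives
> `M(s,ψ) = Y(s,ψ)⁻¹L(1−s,ψ̄)`. Since `|Y(1/2+it,ψ)| = 1`, it follows that
> `|M(1/2+it,ψ)| = |L(1/2+it,ψ)|`,
> `M(1/2+it,ψ) ∈ ℝ`,                                                                       (2.11)
> and, consequently,
> `iM′(1/2+it,ψ) ∈ ℝ`.                                                                      (2.12)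
> […] Assume `ρ ∈ 𝔷(ψ)`. Note that `M′(ρ,ψ) = Y(ρ,ψ)L′(ρ,ψ) ≠ 0`. Write
> `𝒞*(ρ,ψ) = −iM(ρ+β₁,ψ)M(ρ+β₂,ψ)M(ρ+β₃,ψ)/M′(ρ,ψ)`.
> By (2.11) and (2.12) we have `𝒞*(ρ,ψ) ∈ ℝ`.

This file PROVES these assertions for a primitive character `θ` to any modulus `k ≠ 1`
(the source has `k = p` prime), with `Y` any analytic square root of `Z(·,θ)⁻¹` on the upper
half-plane (`GammaFactor.exists_sqrt_inv_Zfac`) and `L(s,θ)` = Mathlib's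
`DirichletCharacter.LFunction θ s`:

* `GammaFactor.LFunction_inv_conj_eq` — conjugation symmetry `L(w,θ̄) = conj L(conj w,θ)` (from
  the tree's `SelbergDirichlet.completedLFunction_conj`, `gammaFactor_conj`, `gammaFactor_inv`);
* `GammaFactor.norm_M_half_eq` — `|M(½+it,θ)| = |L(½+it,θ)|`;
* `GammaFactor.M_half_sq_eq_normSq` — `M(½+it,θ)² = |L(½+it,θ)|²` (from (2.2) in the form
  `yL(s,θ) = y⁻¹L(1−s,θ̄)`, `1 − s = conj s` on the critical line, and conjugation symmetry);
* `GammaFactor.M_half_im_eq_zero` — **(2.11)** `M(½+it,θ) ∈ ℝ`;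
* `GammaFactor.I_mul_deriv_M_half_im_eq_zero` — **(2.12)** `iM′(½+it,θ) ∈ ℝ` (the real function
  `t ↦ M(½+it)` has derivative `iM′(½+it)`);
* `GammaFactor.calCstar_im_eq_zero` — "By (2.11) and (2.12) we have `𝒞*(ρ,ψ) ∈ ℝ`" (p. 5, after
  (2.14)): `Im(−i·M(½+i(γ+v₁))M(½+i(γ+v₂))M(½+i(γ+v₃))/M′(½+iγ)) = 0` for `γ, γ+v_j > 0`
  (`ρ = ½+iγ` on the critical line, `β_j = iv_j` purely imaginary as in (2.13)).
* `GammaFactor.deriv_M_eq_of_LFunction_eq_zero` / `deriv_M_ne_zero_of_simple_zero` — "Note that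
  `M′(ρ,ψ) = Y(ρ,ψ)L′(ρ,ψ) ≠ 0`" (p. 5) at a zero `ρ` of `L(·,θ)` with `Im ρ > 0` (non-vanishing
  for a simple zero, hypothesis `L′(ρ,θ) ≠ 0` — the source takes simplicity from Prop. 2.2 (i)).

Nothing about Theorems 1–2 of the source is stated or implied; nothing here bears on the cell's
verdict on (8.24).

## References

* Y. Zhang, arXiv:2211.02515v1 (2022), §2 p. 5, (2.11)–(2.12).
  [cite: Zhang2022LandauSiegel, §2 (2.11)–(2.12)]
* H. Davenport, *Multiplicative Number Theory*, 2nd ed., GTM 74 (1980), Ch. 9 (functional equation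
  and conjugation symmetry of `L(s,χ)`; consumed via the tree's `SelbergClassDirichletProofs`).
  [cite: DavenportMNT1980, Ch. 9]
-/

noncomputable section

open Complex Real Filter _root_.Topology Set ComplexConjugate

namespace Literature.NumberTheory.LFunctions.Zhang2022.GammaFactor

variable {k : ℕ} [NeZero k]

/-- **Conjugation symmetry** `L(w, θ̄) = conj L(conj w, θ)` for `θ ≠ 1`, `k ≠ 1`, at every `w`
(from `Λ = γ·L`, the tree's `SelbergDirichlet.completedLFunction_conj` and
`gammaFactor_conj` / `gammaFactor_inv`). [cite: DavenportMNT1980, Ch. 9] -/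
theorem LFunction_inv_conj_eq {θ : DirichletCharacter ℂ k} (hθ : θ ≠ 1) (hk : k ≠ 1) (w : ℂ) :
    θ⁻¹.LFunction w = conj (θ.LFunction (conj w)) := by
  rw [DirichletCharacter.LFunction_eq_completed_div_gammaFactor θ⁻¹ w (Or.inr hk),
    DirichletCharacter.LFunction_eq_completed_div_gammaFactor θ (conj w) (Or.inr hk), map_div₀,
    SelbergDirichlet.completedLFunction_conj hθ, SelbergDirichlet.gammaFactor_conj,
    Complex.conj_conj, SelbergDirichlet.gammaFactor_inv]

/-- A primitive character to a modulus `k ≠ 1` is non-trivial. [folklore] -/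
theorem ne_one_of_isPrimitive {θ : DirichletCharacter ℂ k} (hθ : θ.IsPrimitive) (hk : k ≠ 1) :
    θ ≠ 1 := by
  intro h
  apply hk
  have := hθ
  rw [DirichletCharacter.IsPrimitive, h, DirichletCharacter.conductor_one] at this
  exact this.symm

/-- "`|M(½+it,ψ)| = |L(½+it,ψ)|`" (§2 p. 5): for `t > 0` and `y² = Z(½+it,θ)⁻¹` (so `|y| = 1`,
`norm_Zfac_half_eq_one`). [cite: Zhang2022LandauSiegel, §2 p. 5] -/
theorem norm_M_half_eq {θ : DirichletCharacter ℂ k} (hθ : θ.IsPrimitive) {t : ℝ} (ht : 0 < t)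
    {y : ℂ} (hy : y ^ 2 = (Zfac θ (1 / 2 + t * I))⁻¹) :
    ‖y * θ.LFunction (1 / 2 + t * I)‖ = ‖θ.LFunction (1 / 2 + t * I)‖ := by
  have h := congrArg (fun z : ℂ => ‖z‖) hy
  simp only [norm_pow, norm_inv, norm_Zfac_half_eq_one hθ ht, inv_one] at h
  have hy1 : ‖y‖ = 1 := by nlinarith [norm_nonneg y]
  rw [norm_mul, hy1, one_mul]

/-- `M(½+it,θ)² = |L(½+it,θ)|²` for `t > 0`, `θ` primitive mod `k ≠ 1`, `y² = Z(½+it,θ)⁻¹`: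
(2.2) gives `yL(s,θ) = y⁻¹L(1−s,θ̄)`, `1 − s = conj s` on the critical line, and
`L(conj s,θ̄) = conj L(s,θ)`. [cite: Zhang2022LandauSiegel, §2 p. 5] -/
theorem M_half_sq_eq_normSq {θ : DirichletCharacter ℂ k} (hθ : θ.IsPrimitive) (hk : k ≠ 1)
    {t : ℝ} (ht : 0 < t) {y : ℂ} (hy : y ^ 2 = (Zfac θ (1 / 2 + t * I))⁻¹) :
    (y * θ.LFunction (1 / 2 + t * I)) ^ 2 = ((‖θ.LFunction (1 / 2 + t * I)‖ ^ 2 : ℝ) : ℂ) := by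
  have hs : ((1 : ℂ) / 2 + t * I).im ≠ 0 := by simpa using ht.ne'
  have hM := sqrt_inv_Zfac_mul_LFunction hθ hk hs hy
  have hconj : (1 : ℂ) - (1 / 2 + t * I) = conj (1 / 2 + t * I) := by
    apply Complex.ext <;> norm_num
  have hL : θ⁻¹.LFunction (1 - (1 / 2 + t * I)) = conj (θ.LFunction (1 / 2 + t * I)) := by
    rw [hconj, LFunction_inv_conj_eq (ne_one_of_isPrimitive hθ hk) hk, Complex.conj_conj]
  have hy0 : y ≠ 0 := by
    have h := congrArg (fun z : ℂ => ‖z‖) hy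
    simp only [norm_pow, norm_inv, norm_Zfac_half_eq_one hθ ht, inv_one] at h
    have hy1 : ‖y‖ = 1 := by nlinarith [norm_nonneg y]
    exact norm_ne_zero_iff.mp (by rw [hy1]; exact one_ne_zero)
  calc (y * θ.LFunction (1 / 2 + t * I)) ^ 2
      = (y * θ.LFunction (1 / 2 + t * I)) * (y⁻¹ * θ⁻¹.LFunction (1 - (1 / 2 + t * I))) := by
        rw [sq, ← hM]
    _ = θ.LFunction (1 / 2 + t * I) * conj (θ.LFunction (1 / 2 + t * I)) := by
        rw [hL]; field_simp
    _ = ((‖θ.LFunction (1 / 2 + t * I)‖ ^ 2 : ℝ) : ℂ) := by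
        rw [Complex.mul_conj, Complex.normSq_eq_norm_sq]

omit [NeZero k] in
/-- A complex number whose square is a non-negative real is real. [folklore] -/
theorem im_eq_zero_of_sq_eq_ofReal {z : ℂ} {r : ℝ} (hr : 0 ≤ r) (h : z ^ 2 = (r : ℂ)) :
    z.im = 0 := by
  have hre := congrArg Complex.re h
  have him := congrArg Complex.im h
  simp only [sq, Complex.mul_re, Complex.mul_im, Complex.ofReal_re, Complex.ofReal_im] at hre him
  by_contra hne
  have ha : z.re = 0 := by
    have : 2 * z.re * z.im = 0 := by linarith
    rcases mul_eq_zero.mp this with h1 | h1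
    · rcases mul_eq_zero.mp h1 with h2 | h2
      · norm_num at h2
      · exact h2
    · exact absurd h1 hne
  rw [ha] at hre
  have : 0 < z.im * z.im := mul_self_pos.mpr hne
  linarith

/-- **(2.11)** "`M(1/2+it,ψ) ∈ ℝ`": for `θ` primitive mod `k ≠ 1`, `t > 0` and `y² = Z(½+it,θ)⁻¹`,
`y·L(½+it,θ)` is real. [cite: Zhang2022LandauSiegel, §2 (2.11)] -/
theorem M_half_im_eq_zero {θ : DirichletCharacter ℂ k} (hθ : θ.IsPrimitive) (hk : k ≠ 1)
    {t : ℝ} (ht : 0 < t) {y : ℂ} (hy : y ^ 2 = (Zfac θ (1 / 2 + t * I))⁻¹) :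
    (y * θ.LFunction (1 / 2 + t * I)).im = 0 :=
  im_eq_zero_of_sq_eq_ofReal (sq_nonneg _) (M_half_sq_eq_normSq hθ hk ht hy)

/-- **(2.12)** "`iM′(1/2+it,ψ) ∈ ℝ`": for `θ` primitive mod `k ≠ 1`, an analytic square root `Y` of
`Z(·,θ)⁻¹` on the upper half-plane, `M = Y·L(·,θ)` and `t > 0`, `i·M′(½+it)` is real — the real
function `u ↦ M(½+iu)` ((2.11)) has derivative `iM′(½+iu)`. [cite: Zhang2022LandauSiegel, §2 (2.12)] -/
theorem I_mul_deriv_M_half_im_eq_zero {θ : DirichletCharacter ℂ k} (hθ : θ.IsPrimitive) (hk : k ≠ 1)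
    {Y : ℂ → ℂ} (hYd : DifferentiableOn ℂ Y {s : ℂ | 0 < s.im})
    (hY : ∀ s : ℂ, 0 < s.im → Y s ^ 2 = (Zfac θ s)⁻¹) {t : ℝ} (ht : 0 < t) :
    (I * deriv (fun s => Y s * θ.LFunction s) (1 / 2 + t * I)).im = 0 := by
  set M : ℂ → ℂ := fun s => Y s * θ.LFunction s with hM_def
  have hUo : IsOpen {s : ℂ | 0 < s.im} := isOpen_lt continuous_const Complex.continuous_im
  have hθ1 : θ ≠ 1 := ne_one_of_isPrimitive hθ hk
  -- `M` is differentiable at points of the upper half-plane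
  have hMd : ∀ u : ℝ, 0 < u → DifferentiableAt ℂ M (1 / 2 + u * I) := by
    intro u hu
    have hmem : {s : ℂ | 0 < s.im} ∈ 𝓝 ((1 : ℂ) / 2 + u * I) := hUo.mem_nhds (by simpa using hu)
    exact (hYd.differentiableAt hmem).mul
      ((DirichletCharacter.differentiable_LFunction hθ1) _)
  -- the real-variable function `u ↦ M(½ + iu)` and its derivative
  have haff : HasDerivAt (fun u : ℝ => (1 : ℂ) / 2 + u * I) I t := by
    simpa using ((hasDerivAt_id t).ofReal_comp.mul_const I).const_add ((1 : ℂ) / 2)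
  have hcomp := (hMd t ht).hasDerivAt.comp t haff
  -- its imaginary part vanishes identically near `t`, hence has derivative `0`
  have him : HasDerivAt (⇑Complex.imCLM ∘ (M ∘ fun u : ℝ => (1 : ℂ) / 2 + u * I))
      (Complex.imCLM (deriv M (1 / 2 + t * I) * I)) t :=
    Complex.imCLM.hasFDerivAt.comp_hasDerivAt t hcomp
  have hzero : (⇑Complex.imCLM ∘ (M ∘ fun u : ℝ => (1 : ℂ) / 2 + u * I))
      =ᶠ[𝓝 t] fun _ => (0 : ℝ) := by
    filter_upwards [(isOpen_lt continuous_const continuous_id).mem_nhds ht] with u hu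
    simp only [Function.comp_apply, Complex.imCLM_apply, hM_def]
    exact M_half_im_eq_zero hθ hk hu (hY _ (by simpa using hu))
  have him0 : HasDerivAt (⇑Complex.imCLM ∘ (M ∘ fun u : ℝ => (1 : ℂ) / 2 + u * I)) 0 t :=
    (hasDerivAt_const t (0 : ℝ)).congr_of_eventuallyEq hzero
  have huniq := him.unique him0
  rw [Complex.imCLM_apply] at huniq
  -- `(M′·i).im = (i·M′).im`
  rw [mul_comm]
  exact huniq


/-- "By (2.11) and (2.12) we have `𝒞*(ρ,ψ) ∈ ℝ`" (§2 p. 5), where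
`𝒞*(ρ,ψ) = −iM(ρ+β₁,ψ)M(ρ+β₂,ψ)M(ρ+β₃,ψ)/M′(ρ,ψ)`, `ρ = ½ + iγ` is a zero on the critical line and
the `β_j` of (2.13) are purely imaginary: for `θ` primitive mod `k ≠ 1`, `M = Y·L(·,θ)` with `Y` an
analytic square root of `Z(·,θ)⁻¹` on the upper half-plane, `γ > 0` and real `v₁, v₂, v₃` with
`γ + v_j > 0`, `Im(−i·M(½+i(γ+v₁))M(½+i(γ+v₂))M(½+i(γ+v₃))/M′(½+iγ)) = 0`.
[cite: Zhang2022LandauSiegel, §2 p. 5 (after (2.14))] -/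
theorem calCstar_im_eq_zero {θ : DirichletCharacter ℂ k} (hθ : θ.IsPrimitive) (hk : k ≠ 1)
    {Y : ℂ → ℂ} (hYd : DifferentiableOn ℂ Y {s : ℂ | 0 < s.im})
    (hY : ∀ s : ℂ, 0 < s.im → Y s ^ 2 = (Zfac θ s)⁻¹) {γ v₁ v₂ v₃ : ℝ} (hγ : 0 < γ)
    (h₁ : 0 < γ + v₁) (h₂ : 0 < γ + v₂) (h₃ : 0 < γ + v₃) :
    (-I * ((Y (1 / 2 + ((γ + v₁ : ℝ) : ℂ) * I) * θ.LFunction (1 / 2 + ((γ + v₁ : ℝ) : ℂ) * I))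
        * (Y (1 / 2 + ((γ + v₂ : ℝ) : ℂ) * I) * θ.LFunction (1 / 2 + ((γ + v₂ : ℝ) : ℂ) * I))
        * (Y (1 / 2 + ((γ + v₃ : ℝ) : ℂ) * I) * θ.LFunction (1 / 2 + ((γ + v₃ : ℝ) : ℂ) * I)))
      / deriv (fun s => Y s * θ.LFunction s) (1 / 2 + γ * I)).im = 0 := by
  -- a complex number with vanishing imaginary part is the cast of its real part
  have hre : ∀ z : ℂ, z.im = 0 → z = ((z.re : ℝ) : ℂ) := fun z hz =>
    Complex.ext (by simp) (by simp [hz])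
  set a₁ := Y (1 / 2 + ((γ + v₁ : ℝ) : ℂ) * I) * θ.LFunction (1 / 2 + ((γ + v₁ : ℝ) : ℂ) * I)
  set a₂ := Y (1 / 2 + ((γ + v₂ : ℝ) : ℂ) * I) * θ.LFunction (1 / 2 + ((γ + v₂ : ℝ) : ℂ) * I)
  set a₃ := Y (1 / 2 + ((γ + v₃ : ℝ) : ℂ) * I) * θ.LFunction (1 / 2 + ((γ + v₃ : ℝ) : ℂ) * I)
  set d := deriv (fun s => Y s * θ.LFunction s) (1 / 2 + γ * I)
  -- the three values of `M` are real ((2.11)) and so is `i·M′(ρ)` ((2.12))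
  have ha₁ : a₁ = ((a₁.re : ℝ) : ℂ) :=
    hre _ (M_half_im_eq_zero hθ hk h₁ (hY _ (by simpa using h₁)))
  have ha₂ : a₂ = ((a₂.re : ℝ) : ℂ) :=
    hre _ (M_half_im_eq_zero hθ hk h₂ (hY _ (by simpa using h₂)))
  have ha₃ : a₃ = ((a₃.re : ℝ) : ℂ) :=
    hre _ (M_half_im_eq_zero hθ hk h₃ (hY _ (by simpa using h₃)))
  have hd' : I * d = (((I * d).re : ℝ) : ℂ) :=
    hre _ (I_mul_deriv_M_half_im_eq_zero hθ hk hYd hY hγ)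
  -- `−i·X/d = X/(i·d)`
  have key : -I * (a₁ * a₂ * a₃) / d = (a₁ * a₂ * a₃) / (I * d) := by
    rcases eq_or_ne d 0 with hd | hd
    · rw [hd]; simp
    · rw [div_eq_div_iff hd (mul_ne_zero I_ne_zero hd)]
      linear_combination (-(a₁ * a₂ * a₃ * d)) * I_sq
  rw [key, hd', ha₁, ha₂, ha₃]
  norm_cast


/-- "Note that `M′(ρ,ψ) = Y(ρ,ψ)L′(ρ,ψ) ≠ 0`" (§2 p. 5, for `ρ ∈ 𝔷(ψ)`, a zero of `L(s,ψ)` with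
`Im ρ > 0`): the product rule at a zero of `L`. [cite: Zhang2022LandauSiegel, §2 p. 5 (after (2.14))] -/
theorem deriv_M_eq_of_LFunction_eq_zero {θ : DirichletCharacter ℂ k} (hθ1 : θ ≠ 1) {Y : ℂ → ℂ}
    (hYd : DifferentiableOn ℂ Y {s : ℂ | 0 < s.im}) {ρ : ℂ} (hρ : 0 < ρ.im)
    (hL0 : θ.LFunction ρ = 0) :
    deriv (fun s => Y s * θ.LFunction s) ρ = Y ρ * deriv θ.LFunction ρ := by
  have hUo : IsOpen {s : ℂ | 0 < s.im} := isOpen_lt continuous_const Complex.continuous_im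
  have hYa : DifferentiableAt ℂ Y ρ := hYd.differentiableAt (hUo.mem_nhds hρ)
  have hLa : DifferentiableAt ℂ θ.LFunction ρ := (DirichletCharacter.differentiable_LFunction hθ1) ρ
  have h := (hYa.hasDerivAt.mul hLa.hasDerivAt).deriv
  show deriv (Y * θ.LFunction) ρ = _
  rw [h, hL0, mul_zero, zero_add]

/-- … and `M′(ρ,ψ) ≠ 0` when the zero `ρ` is simple (`L′(ρ,ψ) ≠ 0` — Proposition 2.2 (i) of the
source supplies simplicity; here it is the hypothesis `hL1`), since `Y(ρ)² = Z(ρ,θ)⁻¹ ≠ 0`.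
[cite: Zhang2022LandauSiegel, §2 p. 5 (after (2.14))] -/
theorem deriv_M_ne_zero_of_simple_zero {θ : DirichletCharacter ℂ k} (hθ : θ.IsPrimitive) (hk : k ≠ 1)
    {Y : ℂ → ℂ} (hYd : DifferentiableOn ℂ Y {s : ℂ | 0 < s.im})
    (hY : ∀ s : ℂ, 0 < s.im → Y s ^ 2 = (Zfac θ s)⁻¹) {ρ : ℂ} (hρ : 0 < ρ.im)
    (hL0 : θ.LFunction ρ = 0) (hL1 : deriv θ.LFunction ρ ≠ 0) :
    deriv (fun s => Y s * θ.LFunction s) ρ ≠ 0 := by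
  rw [deriv_M_eq_of_LFunction_eq_zero (ne_one_of_isPrimitive hθ hk) hYd hρ hL0]
  refine mul_ne_zero ?_ hL1
  intro h0
  have := hY ρ hρ
  rw [h0, zero_pow two_ne_zero] at this
  exact inv_ne_zero (Zfac_ne_zero hθ hρ) this.symm

end Literature.NumberTheory.LFunctions.Zhang2022.GammaFactor
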